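import Literature.MathematicalPhysics.QuantumFieldTheory.Balaban1983to89.B7Ineq139General
import Literature.MathematicalPhysics.QuantumFieldTheory.Balaban1983to89.B7Prop7LinearBound

/-!
# `Balaban1983to89.B7Ineq139Cplx` — T. Bałaban, *Averaging operations for lattice gauge theories*, Commun. Math. Phys. **98**
(1985) 17–51 [Balaban1985Averaging]: Proposition 5 EXTENDED TO THE COMPLEX BACKGROUND `U′U₀` (p. 43 «Similarly, Proposition 5
may be extended …») — file 1/5: **THE MAJORANT (139) AT A NON-UNITARY BACKGROUND** `W`, in particular at `W = U″V₀`: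
«|Q_{W}A| ≦ Λ·Q|A|, |Q″(W)A| ≦ O(1)(L²α₀ + Lα₁)·Λ·Lᵈ·Q″|A|», `Λ = 1 + O(Lα₁)` the cost of the non-unitary transports

statement-level skeleton of published theorems with citation tags; proofs where landed; nothing here is a claim about the Yang–Mills mass gap

PDF held: `paper:balaban1985-cmp98-averaging` (journal page = PDF page + 16); p. 39 [PDF 23] ((139)–(140)), p. 36 [PDF 20]
((124)–(126)), p. 43 [PDF 27] (Prop. 7 and the sentence after it) read from the materialised text layer
`~/.lit/texts/paper-balaban1985-cmp98-averaging/p0023.txt`, `p0027.txt` (and pp. 36/39 through the verbatim quotations carried by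
`B7Ineq139General` / `B7Prop7LinearBound`, whose architecture this file mirrors line by line).

CITATION HEADER / WHAT IS REPRODUCED.  SKELETON row **B7.Prop7** (cell `lit-balaban`, HOME `run/shared/lean/pub/lit-balaban/`, seat
p06 gen 4 = unit `lit-balaban-p06`; B7 owner r04, referee ref-4), located qualifier of ROWS-B7 v3.7 «the Prop. 5 extension … not
typed»; companion row B7.Eq139 ((139) @gen for a `U1` background: `B7Ineq139General`, p06 gen 3).  p. 43, verbatim: *"Let us
analyze the proof of Proposition 3 first. The bounds depend on bounds of the quantities Y_x = (1/i) log V₀(Γ_{c,x} ∪ (−c)).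
Previously we had |Y_x| = O(L²α₀), but now we allow complex perturbations V′V₀ of V₀, and for these we have |Y_x| = O(L²α₀ + Lα₁)
… Similarly, Proposition 5 may be extended to include analyticity and uniformity statements."*  p. 39: *"From (124) it is clear
that we have the inequalities |Q_{V₀}A| ≦ Q|A|, |Q″(V₀)A| ≦ C′₁L²α₀Q″|A|, (139) where the operator Q is defined as in [2], and Q″
is defined as (Q″A)_c = Σ_{b⊂B(c₋)∪B(c₊)} L^{−d}A_b. (140)"*; p. 36: *"(Q₀A)_c = (Q_{V₀}A)_c = Σ_{x∈B(c₋)} L^{−(d+1)}(R_{0,c₋}A)([x,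
x′]), (125) and it has an estimate |(Q₀A)_c| ≤ |A|. The remaining terms are small because the functions g(−z), g⁻¹(z), e^{iz}
are equal to 1 for z = 0, so the operators occurring in these terms can be estimated by O(L²α₀)"*.

THE PRINTED ROUTE, FOLLOWED.  (124) = `B7Prop3GeneralLinearSplit.linQcov_split` (hypothesis-light: block loops `‖W_x − 1‖ < 1`):
`L(Q(W)A)_c = L·(Q₀A)_c + [three defect brackets]`.  `B7Ineq139General` (p06 gen 3) majorises each rotated contour sum by its
`ℓ¹` MASS for a `U1` background (rotations are isometries) — (139) exactly; `B7Prop7LinearBound` (r04 gen 4) redoes (126) in SUP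
norm at the complex background `W = U″V₀`, where every rotation by a transport `W(Γ)` costs `‖W(Γ)‖‖W(Γ)⁻¹‖ ≤ M^{2|Γ|}`
(`M = 1 + u`, print's census item «|R(W)A| ≤ |W||W⁻¹||A| ≤ e^{O(1)Lα₁}|A|») and the defect operators «equal to 1 for z = 0» are
estimated at the complex loops by `4ε`/`8ε`/`10ε`.  THIS FILE COMBINES THE TWO: the rotated sums over `W` are majorised by
`M^{2|Γ|}` times their MASS (§1), all contours of (124)/(125) have `≤ 3(2d+2)L` letters-with-rotations and live in `B(c₋) ∪ B(c₊)`
(file `B7Ineq139PathMass`), whence (§2–§4) with `M^{3(2d+2)L} ≤ Λ`: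
  `‖L·(Q₀A)_c‖ ≤ Λ·avQ L |A| (c)`,   `‖L(Q(W)A)_c − L·(Q₀A)_c‖ ≤ 136·ε·Λ·Lᵈ·ddQ L |A| (c)`
(`avQ = L·Q` of [2] (1.11), `ddQ = Q″` of (140), `ε` = the block-loop regularity of `W` at `c`) — print's (139) with the factor
`Λ` «|W||W⁻¹|» on the main term and `C′₁L²α₀ ↦ 136εΛLᵈ`; and (§5) at `W = U″V₀` with `V₀ ∈ U1` `α`-regular at `c`, `‖U″ − 1‖,
‖U″⁻¹ − 1‖ ≤ u`, `s = (2d+2)L·u ≤ 1/512`: `Λ = 1 + 6s`, `ε ≤ 2s + α + 2sα`, so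
  `‖L(Q(U″V₀)A)_c‖ ≤ (1 + 6s)·avQ L |A| (c) + (140α + 280s)·Lᵈ·ddQ L |A| (c)`
— the three-term one-step majorant «(1 + O(Lα₁))Q|A| + O(L²α₀ + Lα₁)LᵈQ″|A|» consumed by `B7Prop5CplxLinear` / `B7Prop5CplxInduction`
at every complex level background `Ũ′ʲŪ₀ʲ` (file 4 `B7Prop5CplxLevels` instantiates `α`, `u` by Props. 1–2 and (164)).

DICTIONARY: as in `B7Ineq139General` (`c = ⟨q, q + Le_κ⟩`, «b ⊂ B(c₋)∪B(c₊)» ↦ `S1 L q κ`, `L(Q(W)A)_c ↦ linQcov L W A q κ`,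
`L·(Q₀A)_c ↦ (L : ℝ) • Q0cov L W A q κ`, `|A| ↦ fun x κ ↦ ‖A x κ‖`); `n = (2d+2)L` written `2 * (d * L) + L + L` as in
`B7Prop7LinearBound`.

WHAT THIS FILE PROVES (kernel, 0 sorry, theorems only): §1 `norm_tsum_le_pathMass_general` (`‖(R^{W}_{0,y}A)(Γ)‖ ≤ M^{2|Γ|}·Σ_{b⊂Γ}|A_b|`);
§2 the pieces of (115)/(125) at `W`: `norm_Aloop_le_mass_general` (`≤ 4Λ·Σ_{b⊂B(c₋)∪B(c₊)}|A_b|`), `norm_tsum_bond_le_mass_general`,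
`norm_tsum_tree'_le_mass_general`, **`norm_Q0cov_le_avQ_general`** (`‖L·(Q₀A)_c‖ ≤ Λ·avQ L |A| (c)`); §3 the three brackets of (124)
with masses at `W` (`112εΛ`, `12εΛ`, `12εΛ` × the two-block mass), **`norm_linQcov_sub_main_le_ddQ_general`** (`≤ 136εΛLᵈ·ddQ`);
§4 **`ineq139_nonunitary`**; §5 **`ineq139_cplx`** at `W = U″V₀` (displayed above).
DIVERGENCES from print: constants are admissible witnesses for the unprinted `O(1)`'s, not optimal (exponent budget `3(2d+2)L`,
`Λ − 1 ≤ 6s`, `136` from the defect constants `4ε/8ε/10ε` of `B7Prop7LinearBound`); the extra `Lᵈ` against print's `Q″` is the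
crude «Q ≦ LᵈQ″»-type count of the lineage (`B7Ineq139General` has it too: «C′₁ depends on d and L»); loop regime `ε ≤ 1/8`;
`ℤᵈ`, corner blocks as in the lineage.  REUSED BY NAME: `B7Prop7LinearBound.norm_conjR_le_mul / norm_conjR_hol_le /
norm_conjR_sub_self_le_general / norm_Dmlog_mul_right_sub_self_le_general`, `B7Prop7OneStep.norm_hol_le_pow / norm_bond_cplx_le /
norm_tHol_pert_sub_one_le`, `B7Prop3GeneralLinearBound.norm_Xavg_le / norm_PhiY_sub_self_le / norm_conjR_expUnit_sub_self_le /
norm_wsum_le`, `B7Prop3GeneralLinearSplit.linQcov_split / Aloop_eq / sum_blockWeight`, `B7Ineq139PathMass.*` (masses, block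
inclusions, `sum_S1_eq_ddQ`, `sum_pathMass_seg_eq_avQ`), `B7Prop1Explicit.Wcx_eq_hol_loop / Wcx_mul_eq_tHol_mul / exp_sub_one_le_of_le`.
-/

noncomputable section

open scoped BigOperators
open NormedSpace Finset

namespace Literature.MathematicalPhysics.QuantumFieldTheory.Balaban1983to89.B7Ineq139Cplx

open B7Prop1Explicit B7Prop2Explicit B7Prop3Flat B7Eq92Concrete MatrixLog B7Prop3GeneralRotated B7Prop3GeneralLinear
  B7Prop3GeneralTild B7Prop3GeneralLinearSplit B7Prop3GeneralLinearBound B7Prop3GeneralAnalytic B7Prop5GeneralOperators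
  B7Ineq139PathMass B7Ineq139General B7Prop7OneStep B7Prop7LinearBound
open B7Eq78Linearization (conjR conjR_apply conjR_sub conjR_one)
open B12AverageCorridor267 (Dmlog PhiY PhiY_apply expU)
open B7Prop5Flat (S1)

-- `Site` alone would resolve to the torus sites of `Setup.lean`; re-export the `ℤ^d` sites of `B7Prop1Explicit`.
export B7Prop1Explicit (Site)

variable {d : ℕ}

variable {𝔸 : Type*} [NormedRing 𝔸] [NormedAlgebra ℂ 𝔸] [NormOneClass 𝔸] [CompleteSpace 𝔸]
variable (L : ℕ)

/-! ## §1 Rotated contour sums over a non-unitary background are majorised by `M^{2|Γ|}` times their mass -/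

section Mass

variable {W : Site d → Fin d → 𝔸ˣ} {M : ℝ} (hM : 1 ≤ M)
  (hWb : ∀ x κ, ‖((W x κ : 𝔸ˣ) : 𝔸)‖ ≤ M ∧ ‖(((W x κ)⁻¹ : 𝔸ˣ) : 𝔸)‖ ≤ M)

omit [NormedAlgebra ℂ 𝔸] [NormOneClass 𝔸] [CompleteSpace 𝔸] in
/-- Masses are nonnegative. [folklore] -/
private theorem pathMass_nonneg (A : Site d → Fin d → 𝔸) : ∀ (x : Site d) (w : List (Letter d)), 0 ≤ pathMass A x w
  | _, [] => by simp [pathMass]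
  | x, l :: w => by
    rw [pathMass]
    exact add_nonneg (norm_nonneg _) (pathMass_nonneg A (x + l.vec) w)

omit [NormedAlgebra ℂ 𝔸] [NormOneClass 𝔸] [CompleteSpace 𝔸] in
include hM hWb in
/-- **THE ROTATED SUM (58) OVER A NON-UNITARY BACKGROUND IS MAJORISED BY `M^{2|Γ|}` TIMES ITS MASS**: for `‖W(b)‖, ‖W(b)⁻¹‖ ≤ M`
(`M ≥ 1`), `‖(R^{W}_{0,y}A)(Γ)‖ ≤ M^{2|Γ|}·Σ_{b⊂Γ}|A_b|` — each bond contributes `A_b` rotated by at most `|Γ|` background bonds, each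
rotation costing «|W||W⁻¹|» (the `U1` case `M = 1` is `B7Ineq139PathMass.norm_tsum_le_pathMass`; the sup-norm twin is
`B7Prop7LinearBound.norm_tsum_le_general`). [cite: Balaban1985Averaging, Proposition 7 p.43, (139) p.39, (125)–(126) p.36, (58) p.27] -/
theorem norm_tsum_le_pathMass_general (A : Site d → Fin d → 𝔸) : ∀ (x : Site d) (w : List (Letter d)),
    ‖tsum W A x w‖ ≤ M ^ (2 * w.length) * pathMass A x w
  | x, [] => by simp
  | x, l :: w => by
    have ih := norm_tsum_le_pathMass_general A (x + l.vec) w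
    have hM0 : 0 ≤ M := by linarith
    have hM2 : 1 ≤ M ^ 2 := by nlinarith
    have hs : ‖((stepHol W x l : 𝔸ˣ) : 𝔸)‖ ≤ M ∧ ‖(((stepHol W x l)⁻¹ : 𝔸ˣ) : 𝔸)‖ ≤ M := by
      obtain ⟨μ, b⟩ := l
      cases b
      · rw [stepHol_false, inv_inv]; exact ⟨(hWb _ μ).2, (hWb _ μ).1⟩
      · rw [stepHol_true]; exact hWb x μ
    have hm0 : 0 ≤ pathMass A (x + l.vec) w := pathMass_nonneg A _ _
    have hstep : ‖tstep W A x l‖ ≤ M ^ 2 * ‖A (massSite x l) l.1‖ := by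
      unfold tstep massSite
      split_ifs
      · exact le_mul_of_one_le_left (norm_nonneg _) hM2
      · rw [norm_neg]
        refine (norm_conjR_le_mul _ _).trans ?_
        have h := mul_le_mul (mul_le_mul hs.1 hs.2 (norm_nonneg _) hM0) (le_refl ‖A (x + l.vec) l.1‖) (norm_nonneg _)
          (by positivity)
        refine h.trans (le_of_eq ?_); ring
    have hrot : ‖conjR (stepHol W x l) (tsum W A (x + l.vec) w)‖ ≤ M ^ 2 * (M ^ (2 * w.length) * pathMass A (x + l.vec) w) := by
      refine (norm_conjR_le_mul _ _).trans ?_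
      have h := mul_le_mul (mul_le_mul hs.1 hs.2 (norm_nonneg _) hM0) ih (norm_nonneg _) (by positivity)
      refine h.trans (le_of_eq ?_); ring
    rw [tsum_cons, pathMass, List.length_cons]
    refine (norm_add_le _ _).trans ((add_le_add hstep hrot).trans ?_)
    have hpow : M ^ 2 ≤ M ^ (2 * (w.length + 1)) := pow_le_pow_right₀ hM (by omega)
    have e : M ^ 2 * (M ^ (2 * w.length) * pathMass A (x + l.vec) w) = M ^ (2 * (w.length + 1)) * pathMass A (x + l.vec) w := by
      rw [show 2 * (w.length + 1) = 2 * w.length + 2 by ring, pow_add]; ring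
    rw [e, mul_add (M ^ (2 * (w.length + 1)))]
    exact add_le_add (mul_le_mul_of_nonneg_right hpow (norm_nonneg (A (massSite x l) l.1))) le_rfl

end Mass

/-! ## §2 The pieces of (115)/(125) at a non-unitary background: `Λ` times the two-block mass -/

section Pieces

variable {W : Site d → Fin d → 𝔸ˣ} {M : ℝ} (hM : 1 ≤ M)
  (hWb : ∀ x κ, ‖((W x κ : 𝔸ˣ) : 𝔸)‖ ≤ M ∧ ‖(((W x κ)⁻¹ : 𝔸ˣ) : 𝔸)‖ ≤ M)
  (A : Site d → Fin d → 𝔸) (hL : 1 ≤ L) {Λ : ℝ} (hΛ : M ^ (3 * (2 * (d * L) + L + L)) ≤ Λ) (q : Site d) (κ : Fin d)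

omit [NormedAlgebra ℂ 𝔸] [NormOneClass 𝔸] [CompleteSpace 𝔸] in
include hM hΛ in
/-- every transport budget of (115)/(124)/(125) fits in `3(2d+2)L` background bonds. [folklore] -/
private theorem pow_le_Lambda {m : ℕ} (hm : m ≤ 3 * (2 * (d * L) + L + L)) : M ^ m ≤ Λ :=
  (pow_le_pow_right₀ hM hm).trans hΛ

omit [NormedAlgebra ℂ 𝔸] [NormOneClass 𝔸] [CompleteSpace 𝔸] in
include hM hΛ in
/-- `Λ ≥ 1`. [folklore] -/
private theorem one_le_Lambda : 1 ≤ Λ := (one_le_pow₀ (n := 3 * (2 * (d * L) + L + L)) hM).trans hΛ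

omit [NormedAlgebra ℂ 𝔸] [CompleteSpace 𝔸] in
include hM hWb hL hΛ in
/-- **`‖A_x^{(1)}‖ ≤ 4Λ·Σ_{b⊂B(c₋)∪B(c₊)}|A_b|` at a non-unitary background**: by (115) (`Aloop_eq`) the loop functional is the sum of
four rotated contour sums — along `Γ_{c₋,x}`, `[x, x′]` (rotated by `W(Γ_{c₋,x})`), `Γ_{c₊,x′}` (rotated by `W(Γ_{c,x})`) and the bond `c`
(rotated by the loop `W_x`) — each majorised by `M^{2·(letters)} ≤ Λ` times its mass, and each living in the two blocks.
[cite: Balaban1985Averaging, Proposition 7 p.43, (115) p.34, (139)–(140) p.39] -/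
theorem norm_Aloop_le_mass_general (r : Fin d → Fin L) :
    ‖Aloop L W A q κ (boxVec L r)‖ ≤ 4 * Λ * ∑ b ∈ S1 L q κ, ‖A b.1 b.2‖ := by
  have hL' : 0 < L := hL
  have hM0 : 0 ≤ M := by linarith
  have hl := l1_boxVec_le L r
  set S := ∑ b ∈ S1 L q κ, ‖A b.1 b.2‖
  have hS0 : 0 ≤ S := by positivity
  have hΛ0 : 0 ≤ Λ := le_trans zero_le_one (one_le_Lambda L hM hΛ)
  -- piece 1: the tree contour from the corner
  have h1 : ‖tsum W A q (treeWord (boxVec L r))‖ ≤ Λ * S := by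
    refine (norm_tsum_le_pathMass_general hM hWb A _ _).trans ?_
    rw [length_treeWord]
    exact mul_le_mul (pow_le_Lambda L hM hΛ (by nlinarith)) (pathMass_treeWord_le L A q κ r) (pathMass_nonneg A _ _) hΛ0
  -- piece 2: the segment, rotated along the tree contour
  have h2 : ‖conjR (hol W q (treeWord (boxVec L r))) (tsum W A (q + boxVec L r) (seg κ L))‖ ≤ Λ * S := by
    refine (norm_conjR_hol_le hM hWb q _ _).trans ?_
    have ht := norm_tsum_le_pathMass_general hM hWb A (q + boxVec L r) (seg κ L)
    rw [length_seg, Int.natAbs_natCast] at ht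
    rw [length_treeWord]
    have hpow : M ^ (2 * l1 (boxVec L r)) * M ^ (2 * L) ≤ Λ := by
      rw [← pow_add]; exact pow_le_Lambda L hM hΛ (by nlinarith)
    calc M ^ (2 * l1 (boxVec L r)) * ‖tsum W A (q + boxVec L r) (seg κ ↑L)‖
        ≤ M ^ (2 * l1 (boxVec L r)) * (M ^ (2 * L) * pathMass A (q + boxVec L r) (seg κ ↑L)) :=
          mul_le_mul_of_nonneg_left ht (pow_nonneg hM0 _)
      _ = (M ^ (2 * l1 (boxVec L r)) * M ^ (2 * L)) * pathMass A (q + boxVec L r) (seg κ ↑L) := by ring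
      _ ≤ Λ * S := mul_le_mul hpow (pathMass_seg_le L A q κ r) (pathMass_nonneg A _ _) hΛ0
  -- piece 3: the tree contour in the second block, rotated along `Γ_{c,x}`
  have h3 : ‖conjR (hol W q (gammaWord L κ (boxVec L r))) (tsum W A (q + (L : ℤ) • e κ) (treeWord (boxVec L r)))‖ ≤ Λ * S := by
    refine (norm_conjR_hol_le hM hWb q _ _).trans ?_
    have ht := norm_tsum_le_pathMass_general hM hWb A (q + (L : ℤ) • e κ) (treeWord (boxVec L r))
    rw [length_treeWord] at ht
    rw [length_gammaWord]
    have hpow : M ^ (2 * (2 * l1 (boxVec L r) + L)) * M ^ (2 * l1 (boxVec L r)) ≤ Λ := by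
      rw [← pow_add]; exact pow_le_Lambda L hM hΛ (by nlinarith)
    calc M ^ (2 * (2 * l1 (boxVec L r) + L)) * ‖tsum W A (q + (L : ℤ) • e κ) (treeWord (boxVec L r))‖
        ≤ M ^ (2 * (2 * l1 (boxVec L r) + L)) * (M ^ (2 * l1 (boxVec L r)) * pathMass A (q + (L : ℤ) • e κ) (treeWord (boxVec L r))) :=
          mul_le_mul_of_nonneg_left ht (pow_nonneg hM0 _)
      _ = (M ^ (2 * (2 * l1 (boxVec L r) + L)) * M ^ (2 * l1 (boxVec L r))) *
            pathMass A (q + (L : ℤ) • e κ) (treeWord (boxVec L r)) := by ring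
      _ ≤ Λ * S := mul_le_mul hpow (pathMass_treeWord_le' L A q κ r) (pathMass_nonneg A _ _) hΛ0
  -- piece 4: the bond `c`, rotated by the loop `W_x`
  have h4 : ‖conjR (Wcx L W q κ (boxVec L r)) (tsum W A q (seg κ L))‖ ≤ Λ * S := by
    rw [Wcx_eq_hol_loop]
    refine (norm_conjR_hol_le hM hWb q _ _).trans ?_
    have ht := norm_tsum_le_pathMass_general hM hWb A q (seg κ L)
    rw [length_seg, Int.natAbs_natCast] at ht
    rw [List.length_append, length_gammaWord, length_seg, Int.natAbs_neg, Int.natAbs_natCast]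
    have hpow : M ^ (2 * (2 * l1 (boxVec L r) + L + L)) * M ^ (2 * L) ≤ Λ := by
      rw [← pow_add]; exact pow_le_Lambda L hM hΛ (by nlinarith)
    calc M ^ (2 * (2 * l1 (boxVec L r) + L + L)) * ‖tsum W A q (seg κ ↑L)‖
        ≤ M ^ (2 * (2 * l1 (boxVec L r) + L + L)) * (M ^ (2 * L) * pathMass A q (seg κ ↑L)) :=
          mul_le_mul_of_nonneg_left ht (pow_nonneg hM0 _)
      _ = (M ^ (2 * (2 * l1 (boxVec L r) + L + L)) * M ^ (2 * L)) * pathMass A q (seg κ ↑L) := by ring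
      _ ≤ Λ * S := mul_le_mul hpow (pathMass_seg_corner_le L hL' A q κ) (pathMass_nonneg A _ _) hΛ0
  rw [Aloop_eq]
  have e1 := norm_sub_le (tsum W A q (treeWord (boxVec L r))
    + conjR (hol W q (treeWord (boxVec L r))) (tsum W A (q + boxVec L r) (seg κ L))
    - conjR (hol W q (gammaWord L κ (boxVec L r))) (tsum W A (q + (L : ℤ) • e κ) (treeWord (boxVec L r))))
    (conjR (Wcx L W q κ (boxVec L r)) (tsum W A q (seg κ L)))
  have e2 := norm_sub_le (tsum W A q (treeWord (boxVec L r))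
    + conjR (hol W q (treeWord (boxVec L r))) (tsum W A (q + boxVec L r) (seg κ L)))
    (conjR (hol W q (gammaWord L κ (boxVec L r))) (tsum W A (q + (L : ℤ) • e κ) (treeWord (boxVec L r))))
  have e3 := norm_add_le (tsum W A q (treeWord (boxVec L r)))
    (conjR (hol W q (treeWord (boxVec L r))) (tsum W A (q + boxVec L r) (seg κ L)))
  linarith

omit [NormedAlgebra ℂ 𝔸] [NormOneClass 𝔸] [CompleteSpace 𝔸] in
include hM hWb hL hΛ in
/-- `‖(R^{W}_{0,c₋}A)(c)‖ ≤ Λ·Σ_{b⊂B(c₋)∪B(c₊)}|A_b|` (the bond `c` is the segment from the corner). [cite: Balaban1985Averaging, Proposition 7 p.43, (139)–(140) p.39] -/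
theorem norm_tsum_bond_le_mass_general : ‖tsum W A q (seg κ L)‖ ≤ Λ * ∑ b ∈ S1 L q κ, ‖A b.1 b.2‖ := by
  have hL' : 0 < L := hL
  have hΛ0 : 0 ≤ Λ := le_trans zero_le_one (one_le_Lambda L hM hΛ)
  have ht := norm_tsum_le_pathMass_general hM hWb A q (seg κ L)
  rw [length_seg, Int.natAbs_natCast] at ht
  exact ht.trans (mul_le_mul (pow_le_Lambda L hM hΛ (by nlinarith)) (pathMass_seg_corner_le L hL' A q κ)
    (pathMass_nonneg A _ _) hΛ0)

omit [NormedAlgebra ℂ 𝔸] [CompleteSpace 𝔸] in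
include hM hWb hL hΛ in
/-- `‖R(W(c))(R^{W}_{0,c₊}A)(Γ_{c₊,x′})‖ ≤ Λ·Σ_{b⊂B(c₋)∪B(c₊)}|A_b|`. [cite: Balaban1985Averaging, Proposition 7 p.43, (139)–(140) p.39] -/
theorem norm_tsum_tree'_le_mass_general (r : Fin d → Fin L) :
    ‖conjR (hol W q (seg κ L)) (tsum W A (q + (L : ℤ) • e κ) (treeWord (boxVec L r)))‖
      ≤ Λ * ∑ b ∈ S1 L q κ, ‖A b.1 b.2‖ := by
  have hM0 : 0 ≤ M := by linarith
  have hl := l1_boxVec_le L r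
  have hΛ0 : 0 ≤ Λ := le_trans zero_le_one (one_le_Lambda L hM hΛ)
  refine (norm_conjR_hol_le hM hWb q _ _).trans ?_
  have ht := norm_tsum_le_pathMass_general hM hWb A (q + (L : ℤ) • e κ) (treeWord (boxVec L r))
  rw [length_treeWord] at ht
  rw [length_seg, Int.natAbs_natCast]
  have hpow : M ^ (2 * L) * M ^ (2 * l1 (boxVec L r)) ≤ Λ := by
    rw [← pow_add]; exact pow_le_Lambda L hM hΛ (by nlinarith)
  calc M ^ (2 * L) * ‖tsum W A (q + (L : ℤ) • e κ) (treeWord (boxVec L r))‖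
      ≤ M ^ (2 * L) * (M ^ (2 * l1 (boxVec L r)) * pathMass A (q + (L : ℤ) • e κ) (treeWord (boxVec L r))) :=
        mul_le_mul_of_nonneg_left ht (pow_nonneg hM0 _)
    _ = (M ^ (2 * L) * M ^ (2 * l1 (boxVec L r))) * pathMass A (q + (L : ℤ) • e κ) (treeWord (boxVec L r)) := by ring
    _ ≤ Λ * ∑ b ∈ S1 L q κ, ‖A b.1 b.2‖ :=
        mul_le_mul hpow (pathMass_treeWord_le' L A q κ r) (pathMass_nonneg A _ _) hΛ0

omit [CompleteSpace 𝔸] in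
include hM hWb hL hΛ in
/-- **(139), FIRST HALF, AT A NON-UNITARY BACKGROUND: «|Q_{W}A| ≦ Λ·Q|A|»** for the main term (125), in «L(Q(W)A)_c» units:
`‖L·(Q₀A)_c‖ ≤ Λ·avQ L |A| (c)` — each rotated segment sum `≤ M^{2(|Γ_{c₋,x}|+L)} ≤ Λ` times the segment's mass, summed with the
weights `L^{−(d+1)}`, and the segment masses sum to `Q|A|` exactly; print's «|(Q₀A)_c| ≦ |A|» acquires the factor «|W||W⁻¹| ≤
e^{O(1)Lα₁}». [cite: Balaban1985Averaging, Proposition 7 p.43, (139) p.39, (125)–(126) p.36] -/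
theorem norm_Q0cov_le_avQ_general : ‖(L : ℝ) • Q0cov L W A q κ‖ ≤ Λ * avQ L (fun x μ => ‖A x μ‖) q κ := by
  have hL' : 0 < L := hL
  have hM0 : 0 ≤ M := by linarith
  have hΛ0 : 0 ≤ Λ := le_trans zero_le_one (one_le_Lambda L hM hΛ)
  rw [← sum_pathMass_seg_eq_avQ L hL' A q κ, norm_smul, Real.norm_of_nonneg (Nat.cast_nonneg L), Q0cov, ← mul_assoc,
    mul_comm Λ (L : ℝ), mul_assoc, Finset.mul_sum]
  refine mul_le_mul_of_nonneg_left (norm_sum_le_of_le _ fun r _ => ?_) (Nat.cast_nonneg L)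
  rw [norm_smul, Real.norm_of_nonneg (by positivity), ← mul_assoc, mul_comm Λ, mul_assoc]
  refine mul_le_mul_of_nonneg_left ?_ (by positivity)
  refine (norm_conjR_hol_le hM hWb q _ _).trans ?_
  have ht := norm_tsum_le_pathMass_general hM hWb A (q + boxVec L r) (seg κ L)
  rw [length_seg, Int.natAbs_natCast] at ht
  rw [length_treeWord]
  have hl := l1_boxVec_le L r
  have hpow : M ^ (2 * l1 (boxVec L r)) * M ^ (2 * L) ≤ Λ := by
    rw [← pow_add]; exact pow_le_Lambda L hM hΛ (by nlinarith)
  calc M ^ (2 * l1 (boxVec L r)) * ‖tsum W A (q + boxVec L r) (seg κ ↑L)‖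
      ≤ M ^ (2 * l1 (boxVec L r)) * (M ^ (2 * L) * pathMass A (q + boxVec L r) (seg κ ↑L)) :=
        mul_le_mul_of_nonneg_left ht (pow_nonneg hM0 _)
    _ = (M ^ (2 * l1 (boxVec L r)) * M ^ (2 * L)) * pathMass A (q + boxVec L r) (seg κ ↑L) := by ring
    _ ≤ Λ * pathMass A (q + boxVec L r) (seg κ ↑L) := mul_le_mul_of_nonneg_right hpow (pathMass_nonneg A _ _)

end Pieces

/-! ## §3 The three defect brackets of (124) with masses at a non-unitary background -/

section Brackets

variable {W : Site d → Fin d → 𝔸ˣ} {M : ℝ} (hM : 1 ≤ M)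
  (hWb : ∀ x κ, ‖((W x κ : 𝔸ˣ) : 𝔸)‖ ≤ M ∧ ‖(((W x κ)⁻¹ : 𝔸ˣ) : 𝔸)‖ ≤ M)
  (A : Site d → Fin d → 𝔸) (hL : 1 ≤ L) {Λ : ℝ} (hΛ : M ^ (3 * (2 * (d * L) + L + L)) ≤ Λ) (q : Site d) (κ : Fin d)
  {ε : ℝ} (hε0 : 0 ≤ ε) (hε : ε ≤ 1 / 8)
  (hWl : ∀ r : Fin d → Fin L, ‖((Wcx L W q κ (boxVec L r) : 𝔸ˣ) : 𝔸) - 1‖ ≤ ε)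

include hM hWb hL hΛ hε0 hε hWl in
/-- FIRST BRACKET of (124) with masses at `W`: `‖Φ(Σ_x L^{−d}Ψ_x(A_x^{(1)})) − Σ_x L^{−d}A_x^{(1)}‖ ≤ 112·ε·Λ·Σ_{b⊂B(c₋)∪B(c₊)}|A_b|`
(`28ε` times the uniform loop bound `4Λ·Σ|A_b|`; the `D log` defect at the complex loops is `10ε`, `Φ − 1` is `8ε`).
[cite: Balaban1985Averaging, Proposition 7 p.43, (124)–(126) p.36, (139) p.39] -/
theorem norm_bracket1_le_mass_general :
    ‖PhiY (Xavg L W q κ) (DXavg L W A q κ)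
        - ∑ r : Fin d → Fin L, (((L : ℝ) ^ d)⁻¹) • Aloop L W A q κ (boxVec L r)‖
      ≤ 112 * ε * Λ * ∑ b ∈ S1 L q κ, ‖A b.1 b.2‖ := by
  set ℓ : ℝ := 4 * Λ * ∑ b ∈ S1 L q κ, ‖A b.1 b.2‖ with hℓ
  have hΛ0 : 0 ≤ Λ := le_trans (pow_nonneg (by linarith) _) hΛ
  have hℓ0 : 0 ≤ ℓ := by positivity
  have hX := norm_Xavg_le L hL W q κ hε hWl
  have hAl : ∀ r, ‖Aloop L W A q κ (boxVec L r)‖ ≤ ℓ := fun r => norm_Aloop_le_mass_general L hM hWb A hL hΛ q κ r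
  set S := ∑ r : Fin d → Fin L, (((L : ℝ) ^ d)⁻¹) • Aloop L W A q κ (boxVec L r) with hS
  have hin : ‖DXavg L W A q κ - S‖ ≤ 10 * ε * ℓ := by
    rw [hS, DXavg, ← Finset.sum_sub_distrib]
    simp_rw [← smul_sub]
    refine norm_wsum_le L hL fun r => ?_
    refine (norm_Dmlog_mul_right_sub_self_le_general hε (hWl r) _).trans ?_
    exact mul_le_mul_of_nonneg_left (hAl r) (by positivity)
  have hSn : ‖S‖ ≤ ℓ := norm_wsum_le L hL hAl
  have hDX : ‖DXavg L W A q κ‖ ≤ 10 * ε * ℓ + ℓ := by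
    have h := norm_add_le (DXavg L W A q κ - S) S
    rw [sub_add_cancel] at h
    linarith
  have hΦ := norm_PhiY_sub_self_le hX hε (DXavg L W A q κ)
  have key : ‖PhiY (Xavg L W q κ) (DXavg L W A q κ) - S‖ ≤ 8 * ε * (10 * ε * ℓ + ℓ) + 10 * ε * ℓ := by
    have h := norm_add_le (PhiY (Xavg L W q κ) (DXavg L W A q κ) - DXavg L W A q κ) (DXavg L W A q κ - S)
    rw [sub_add_sub_cancel] at h
    have h8 : 8 * ε * ‖DXavg L W A q κ‖ ≤ 8 * ε * (10 * ε * ℓ + ℓ) := mul_le_mul_of_nonneg_left hDX (by positivity)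
    linarith
  have h8 : 8 * ε ≤ 1 := by linarith
  have h6 : 0 ≤ 10 * ε * ℓ := by positivity
  have hε2 : 8 * ε * (10 * ε * ℓ) ≤ 10 * ε * ℓ := by
    calc 8 * ε * (10 * ε * ℓ) ≤ 1 * (10 * ε * ℓ) := mul_le_mul_of_nonneg_right h8 h6
      _ = 10 * ε * ℓ := one_mul _
  have e : 8 * ε * (10 * ε * ℓ + ℓ) = 8 * ε * (10 * ε * ℓ) + 8 * ε * ℓ := by ring
  calc ‖PhiY (Xavg L W q κ) (DXavg L W A q κ) - S‖ ≤ 8 * ε * (10 * ε * ℓ + ℓ) + 10 * ε * ℓ := key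
    _ ≤ 28 * ε * ℓ := by rw [e]; linarith
    _ = 112 * ε * Λ * ∑ b ∈ S1 L q κ, ‖A b.1 b.2‖ := by rw [hℓ]; ring

include hM hWb hL hΛ hε0 hε hWl in
/-- SECOND BRACKET of (124) with masses at `W`: `‖[e^{i ad_Y} − Σ_x L^{−d}R(W_x)]((R^{W}_{0,c₋}A)(c))‖ ≤ 12·ε·Λ·Σ_{b⊂B(c₋)∪B(c₊)}|A_b|`.
[cite: Balaban1985Averaging, Proposition 7 p.43, (124)–(126) p.36, (139) p.39] -/
theorem norm_bracket2_le_mass_general :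
    ‖conjR (expUnit (Xavg L W q κ)) (tsum W A q (seg κ L))
        - ∑ r : Fin d → Fin L, (((L : ℝ) ^ d)⁻¹) • conjR (Wcx L W q κ (boxVec L r)) (tsum W A q (seg κ L))‖
      ≤ 12 * ε * Λ * ∑ b ∈ S1 L q κ, ‖A b.1 b.2‖ := by
  set Rc := tsum W A q (seg κ L) with hRc
  have hR : ‖Rc‖ ≤ Λ * ∑ b ∈ S1 L q κ, ‖A b.1 b.2‖ := norm_tsum_bond_le_mass_general L hM hWb A hL hΛ q κ
  have hX := norm_Xavg_le L hL W q κ hε hWl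
  have h1 : ‖conjR (expUnit (Xavg L W q κ)) Rc - Rc‖ ≤ 8 * ε * ‖Rc‖ := norm_conjR_expUnit_sub_self_le hX hε Rc
  have h2 : ‖∑ r : Fin d → Fin L, (((L : ℝ) ^ d)⁻¹) • conjR (Wcx L W q κ (boxVec L r)) Rc - Rc‖ ≤ 4 * ε * ‖Rc‖ := by
    have e : ∑ r : Fin d → Fin L, (((L : ℝ) ^ d)⁻¹) • conjR (Wcx L W q κ (boxVec L r)) Rc - Rc
        = ∑ r : Fin d → Fin L, (((L : ℝ) ^ d)⁻¹) • (conjR (Wcx L W q κ (boxVec L r)) Rc - Rc) := by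
      simp_rw [smul_sub]
      rw [Finset.sum_sub_distrib, sum_blockWeight (d := d) L hL Rc]
    rw [e]
    exact norm_wsum_le L hL fun r => norm_conjR_sub_self_le_general (hWl r) hε Rc
  have h := norm_sub_le (conjR (expUnit (Xavg L W q κ)) Rc - Rc)
    (∑ r : Fin d → Fin L, (((L : ℝ) ^ d)⁻¹) • conjR (Wcx L W q κ (boxVec L r)) Rc - Rc)
  rw [sub_sub_sub_cancel_right] at h
  have hS0 : 0 ≤ Λ * ∑ b ∈ S1 L q κ, ‖A b.1 b.2‖ := le_trans (norm_nonneg _) hR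
  have h82 : 8 * ε * ‖Rc‖ + 4 * ε * ‖Rc‖ ≤ 12 * ε * (Λ * ∑ b ∈ S1 L q κ, ‖A b.1 b.2‖) := by nlinarith
  linarith

include hM hWb hL hΛ hε0 hε hWl in
/-- THIRD BRACKET of (124) with masses at `W`: `‖Σ_{x′} L^{−d}[e^{i ad_Y} − R(W_x)]R(W(c))(R^{W}_{0,c₊}A)(Γ_{c₊,x′})‖ ≤
12·ε·Λ·Σ_{b⊂B(c₋)∪B(c₊)}|A_b|`. [cite: Balaban1985Averaging, Proposition 7 p.43, (124)–(126) p.36, (139) p.39] -/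
theorem norm_bracket3_le_mass_general :
    ‖∑ r : Fin d → Fin L, (((L : ℝ) ^ d)⁻¹) •
        (conjR (expUnit (Xavg L W q κ))
            (conjR (hol W q (seg κ L)) (tsum W A (q + (L : ℤ) • e κ) (treeWord (boxVec L r))))
          - conjR (Wcx L W q κ (boxVec L r))
            (conjR (hol W q (seg κ L)) (tsum W A (q + (L : ℤ) • e κ) (treeWord (boxVec L r)))))‖
      ≤ 12 * ε * Λ * ∑ b ∈ S1 L q κ, ‖A b.1 b.2‖ := by
  have hX := norm_Xavg_le L hL W q κ hε hWl
  refine norm_wsum_le L hL fun r => ?_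
  set Y := conjR (hol W q (seg κ L)) (tsum W A (q + (L : ℤ) • e κ) (treeWord (boxVec L r))) with hY
  have hYn : ‖Y‖ ≤ Λ * ∑ b ∈ S1 L q κ, ‖A b.1 b.2‖ := norm_tsum_tree'_le_mass_general L hM hWb A hL hΛ q κ r
  have h1 := norm_conjR_expUnit_sub_self_le hX hε Y
  have h2 := norm_conjR_sub_self_le_general (hWl r) hε Y
  have h := norm_sub_le (conjR (expUnit (Xavg L W q κ)) Y - Y) (conjR (Wcx L W q κ (boxVec L r)) Y - Y)
  rw [sub_sub_sub_cancel_right] at h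
  have hS0 : 0 ≤ Λ * ∑ b ∈ S1 L q κ, ‖A b.1 b.2‖ := le_trans (norm_nonneg _) hYn
  have h82 : 8 * ε * ‖Y‖ + 4 * ε * ‖Y‖ ≤ 12 * ε * (Λ * ∑ b ∈ S1 L q κ, ‖A b.1 b.2‖) := by nlinarith
  linarith

include hM hWb hL hΛ hε0 hε hWl in
/-- **THE REMAINDER `Q″(W)A` OF (124) IS MAJORISED BY THE TWO-BLOCK MASS AT A NON-UNITARY BACKGROUND**:
`‖L(Q(W)A)_c − L·(Q₀A)_c‖ ≤ 136·ε·Λ·Σ_{b⊂B(c₋)∪B(c₊)}|A_b|` for block loops `‖W_x − 1‖ ≤ ε ≤ 1∕8`.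
[cite: Balaban1985Averaging, Proposition 7 p.43, (139)–(140) p.39, (124) p.36] -/
theorem norm_linQcov_sub_main_le_mass_general :
    ‖linQcov L W A q κ - (L : ℝ) • Q0cov L W A q κ‖ ≤ 136 * ε * Λ * ∑ b ∈ S1 L q κ, ‖A b.1 b.2‖ := by
  have hW1 : ∀ r : Fin d → Fin L, ‖((Wcx L W q κ (boxVec L r) : 𝔸ˣ) : 𝔸) - 1‖ < 1 :=
    fun r => (hWl r).trans_lt (by linarith)
  have h1 := norm_bracket1_le_mass_general L hM hWb A hL hΛ q κ hε0 hε hWl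
  have h2 := norm_bracket2_le_mass_general L hM hWb A hL hΛ q κ hε0 hε hWl
  have h3 := norm_bracket3_le_mass_general L hM hWb A hL hΛ q κ hε0 hε hWl
  rw [linQcov_split L hL W A q κ hW1, add_assoc, add_assoc, add_sub_cancel_left]
  refine (norm_add_le _ _).trans ?_
  refine (add_le_add h1 ((norm_add_le _ _).trans (add_le_add h2 h3))).trans ?_
  linarith

include hM hWb hL hΛ hε0 hε hWl in
/-- **(139), SECOND HALF, AT A NON-UNITARY BACKGROUND: «|Q″(W)A| ≦ O(1)·ε·Λ·Q″|A|»** in «L(Q(W)A)_c» units: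
`‖L(Q(W)A)_c − L·(Q₀A)_c‖ ≤ 136·ε·Λ·Lᵈ·ddQ L |A| (c)` (`ddQ = Q″` of (140)). [cite: Balaban1985Averaging, Proposition 7 p.43, (139)–(140) p.39] -/
theorem norm_linQcov_sub_main_le_ddQ_general :
    ‖linQcov L W A q κ - (L : ℝ) • Q0cov L W A q κ‖ ≤ 136 * ε * Λ * (L : ℝ) ^ d * ddQ L (fun x μ => ‖A x μ‖) q κ := by
  have h := norm_linQcov_sub_main_le_mass_general L hM hWb A hL hΛ q κ hε0 hε hWl
  rwa [sum_S1_eq_ddQ L hL A q κ, ← mul_assoc] at h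

end Brackets

/-! ## §4 (139) assembled at a non-unitary background -/

section Majorant

variable {W : Site d → Fin d → 𝔸ˣ} {M : ℝ} (hM : 1 ≤ M)
  (hWb : ∀ x κ, ‖((W x κ : 𝔸ˣ) : 𝔸)‖ ≤ M ∧ ‖(((W x κ)⁻¹ : 𝔸ˣ) : 𝔸)‖ ≤ M)
  (A : Site d → Fin d → 𝔸) (hL : 1 ≤ L) {Λ : ℝ} (hΛ : M ^ (3 * (2 * (d * L) + L + L)) ≤ Λ) (q : Site d) (κ : Fin d)

include hM hWb hL hΛ in
/-- **(139) AT A NON-UNITARY BACKGROUND, LOOP REGIME**: `‖L(Q(W)A)_c‖ ≤ Λ·avQ L |A| (c) + 136·ε·Λ·Lᵈ·ddQ L |A| (c)` — i.e.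
`|(Q(W)A)_c| ≤ Λ(Q|A|)_c + O(1)εΛLᵈ(Q″|A|)_c` — for `‖W(b)‖, ‖W(b)⁻¹‖ ≤ M`, `M^{3(2d+2)L} ≤ Λ`, block loops at `c` within
`ε ≤ 1∕8` of `1`. [cite: Balaban1985Averaging, Proposition 7 p.43, (139)–(140) p.39] -/
theorem ineq139_nonunitary {ε : ℝ} (hε0 : 0 ≤ ε) (hε : ε ≤ 1 / 8)
    (hWl : ∀ r : Fin d → Fin L, ‖((Wcx L W q κ (boxVec L r) : 𝔸ˣ) : 𝔸) - 1‖ ≤ ε) :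
    ‖linQcov L W A q κ‖ ≤
      Λ * avQ L (fun x μ => ‖A x μ‖) q κ + 136 * ε * Λ * (L : ℝ) ^ d * ddQ L (fun x μ => ‖A x μ‖) q κ := by
  have hmain := norm_Q0cov_le_avQ_general L hM hWb A hL hΛ q κ
  have h := norm_linQcov_sub_main_le_ddQ_general L hM hWb A hL hΛ q κ hε0 hε hWl
  have h' := norm_add_le (linQcov L W A q κ - (L : ℝ) • Q0cov L W A q κ) ((L : ℝ) • Q0cov L W A q κ)
  rw [sub_add_cancel] at h'
  linarith

end Majorant

/-! ## §5 (139) at the complex background `U″V₀`: «|Y_x| = O(L²α₀ + Lα₁)» -/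

section Complex

/-- **THE ONE-STEP MAJORANT (139) AT THE COMPLEX BACKGROUND `U″V₀` — p. 43 «now we allow complex perturbations V′V₀ of V₀, and
for these we have |Y_x| = O(L²α₀ + Lα₁)», applied to (139) as print's «Similarly, Proposition 5 may be extended …» asks**: for `V₀`
unit-bounded with block loops at `c = (q, κ)` within `α ≤ 1/16` of `1` (Prop. 1: `α = O(L²α₀)`), a unit-valued perturbation `U″` with
`‖U″(b) − 1‖, ‖U″(b)⁻¹ − 1‖ ≤ u` and `s := (2d+2)L·u ≤ 1/512` (print's `Lα₁`):
  `‖L(Q(U″V₀)A)_c‖ ≤ (1 + 6s)·avQ L |A| (c) + (140α + 280s)·Lᵈ·ddQ L |A| (c)`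
— «|Q_{U″V₀}A| ≦ (1 + O(Lα₁))Q|A|, |Q″(U″V₀)A| ≦ O(1)(L²α₀ + Lα₁)LᵈQ″|A|».  Mechanism: the block loops of `U″V₀` are within
`ε ≤ 2s + α + 2sα ≤ 1/8` of `1` (`B7Prop7OneStep`: `W_x(U″V₀) = (R^{V₀}_0U″)(loop)·W_x(V₀)`), the transports cost
`Λ = (1+u)^{3(2d+2)L} ≤ 1 + 6s`, and §4. [cite: Balaban1985Averaging, Proposition 7 p.43, (139)–(140) p.39] -/
theorem ineq139_cplx (hL : 1 ≤ L) {V₀ U'' : Site d → Fin d → 𝔸ˣ} (hV₀ : ∀ x κ, V₀ x κ ∈ U1 𝔸) {u : ℝ} (hu : 0 ≤ u)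
    (hU : ∀ x κ, ‖((U'' x κ : 𝔸ˣ) : 𝔸) - 1‖ ≤ u ∧ ‖(((U'' x κ)⁻¹ : 𝔸ˣ) : 𝔸) - 1‖ ≤ u)
    (hun : ((2 * (d * L) + L + L : ℕ) : ℝ) * u ≤ 1 / 512)
    (A : Site d → Fin d → 𝔸) (q : Site d) (κ : Fin d) {α : ℝ} (hα1 : α ≤ 1 / 16)
    (hreg : ∀ r : Fin d → Fin L, ‖((Wcx L V₀ q κ (boxVec L r) : 𝔸ˣ) : 𝔸) - 1‖ ≤ α) :
    ‖linQcov L (U'' * V₀) A q κ‖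
      ≤ (1 + 6 * (((2 * (d * L) + L + L : ℕ) : ℝ) * u)) * avQ L (fun x μ => ‖A x μ‖) q κ
        + (140 * α + 280 * (((2 * (d * L) + L + L : ℕ) : ℝ) * u)) * (L : ℝ) ^ d * ddQ L (fun x μ => ‖A x μ‖) q κ := by
  set n : ℕ := 2 * (d * L) + L + L with hn
  set s : ℝ := (n : ℝ) * u with hs
  have hs0 : 0 ≤ s := by positivity
  have hs1 : s ≤ 1 / 512 := hun
  have hα0 : 0 ≤ α := by
    have := hreg (fun _ => ⟨0, by omega⟩)
    exact (norm_nonneg _).trans this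
  -- the transport growth `Λ = (1+u)^{3n} ≤ e^{3s} ≤ 1 + 6s`
  have hΛ : (1 + u) ^ (3 * n) ≤ 1 + 6 * s := by
    have h1 : (1 + u) ^ (3 * n) ≤ Real.exp (3 * s) := by
      rw [hs, show 3 * ((n : ℝ) * u) = ((3 * n : ℕ) : ℝ) * u by push_cast; ring, Real.exp_nat_mul]
      exact pow_le_pow_left₀ (by positivity) (by linarith [Real.add_one_le_exp u]) _
    have h2 := exp_sub_one_le_of_le (le_refl (3 * s)) (by positivity) (by linarith)
    linarith
  -- the block loops of `W = U″V₀` at `c`: `ε ≤ 2s + α + 2sα ≤ 1/8`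
  have hloopU : ∀ r : Fin d → Fin L,
      ‖((tHol V₀ U'' q (gammaWord L κ (boxVec L r) ++ seg κ (-(L : ℤ))) : 𝔸ˣ) : 𝔸) - 1‖ ≤ 2 * s := by
    intro r
    have hlen : (gammaWord L κ (boxVec L r) ++ seg κ (-(L : ℤ))).length ≤ n := by
      rw [List.length_append, length_gammaWord, length_seg, Int.natAbs_neg, Int.natAbs_natCast]
      have := l1_boxVec_le (L := L) r; omega
    refine (norm_tHol_pert_sub_one_le hV₀ hu hU _ q).trans ?_
    have hle : (((gammaWord L κ (boxVec L r) ++ seg κ (-(L : ℤ))).length : ℕ) : ℝ) * u ≤ s :=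
      (mul_le_mul_of_nonneg_right (by exact_mod_cast hlen) hu)
    exact exp_sub_one_le_of_le hle hs0 (by linarith)
  have hWl : ∀ r : Fin d → Fin L,
      ‖((Wcx L (U'' * V₀) q κ (boxVec L r) : 𝔸ˣ) : 𝔸) - 1‖ ≤ 2 * s + α + 2 * s * α := by
    intro r
    rw [Wcx_mul_eq_tHol_mul, Units.val_mul]
    have hX := hloopU r
    have hY := hreg r
    have h : ((tHol V₀ U'' q (gammaWord L κ (boxVec L r) ++ seg κ (-(L : ℤ))) : 𝔸ˣ) : 𝔸) *
        ((Wcx L V₀ q κ (boxVec L r) : 𝔸ˣ) : 𝔸) - 1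
        = (((tHol V₀ U'' q (gammaWord L κ (boxVec L r) ++ seg κ (-(L : ℤ))) : 𝔸ˣ) : 𝔸) - 1) *
            (((Wcx L V₀ q κ (boxVec L r) : 𝔸ˣ) : 𝔸) - 1)
          + (((tHol V₀ U'' q (gammaWord L κ (boxVec L r) ++ seg κ (-(L : ℤ))) : 𝔸ˣ) : 𝔸) - 1)
          + (((Wcx L V₀ q κ (boxVec L r) : 𝔸ˣ) : 𝔸) - 1) := by noncomm_ring
    rw [h]
    calc _ ≤ ‖(((tHol V₀ U'' q (gammaWord L κ (boxVec L r) ++ seg κ (-(L : ℤ))) : 𝔸ˣ) : 𝔸) - 1) *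
            (((Wcx L V₀ q κ (boxVec L r) : 𝔸ˣ) : 𝔸) - 1)‖
          + ‖((tHol V₀ U'' q (gammaWord L κ (boxVec L r) ++ seg κ (-(L : ℤ))) : 𝔸ˣ) : 𝔸) - 1‖
          + ‖((Wcx L V₀ q κ (boxVec L r) : 𝔸ˣ) : 𝔸) - 1‖ := norm_add₃_le
      _ ≤ 2 * s * α + 2 * s + α := by
          gcongr
          exact (norm_mul_le _ _).trans (mul_le_mul hX hY (norm_nonneg _) (by positivity))
      _ = 2 * s + α + 2 * s * α := by ring
  have hε8 : 2 * s + α + 2 * s * α ≤ 1 / 8 := by nlinarith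
  -- §4 at `W = U″V₀` with `M = 1 + u`, `Λ = 1 + 6s`
  have h := ineq139_nonunitary L (W := U'' * V₀) (M := 1 + u) (by linarith) (norm_bond_cplx_le hV₀ hU) A hL
    (Λ := 1 + 6 * s) hΛ q κ (by positivity) hε8 hWl
  refine h.trans ?_
  have hav0 : 0 ≤ avQ L (fun x μ => ‖A x μ‖) q κ := avQ_nonneg L (fun _ _ => norm_nonneg _) q κ
  have hdd0 : 0 ≤ (L : ℝ) ^ d * ddQ L (fun x μ => ‖A x μ‖) q κ :=
    mul_nonneg (by positivity) (ddQ_nonneg L (fun _ _ => norm_nonneg _) q κ)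
  have hcoef : 136 * (2 * s + α + 2 * s * α) * (1 + 6 * s) ≤ 140 * α + 280 * s := by
    nlinarith [mul_nonneg hs0 hα0, mul_nonneg (mul_nonneg hs0 hs0) hα0, mul_nonneg hs0 hs0,
      mul_le_mul_of_nonneg_right hs1 hα0, mul_le_mul_of_nonneg_right hs1 hs0,
      mul_le_mul_of_nonneg_right hs1 (mul_nonneg hs0 hα0)]
  have e : 136 * (2 * s + α + 2 * s * α) * (1 + 6 * s) * (L : ℝ) ^ d * ddQ L (fun x μ => ‖A x μ‖) q κ
      = 136 * (2 * s + α + 2 * s * α) * (1 + 6 * s) * ((L : ℝ) ^ d * ddQ L (fun x μ => ‖A x μ‖) q κ) := by ring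
  rw [e]
  calc (1 + 6 * s) * avQ L (fun x μ => ‖A x μ‖) q κ
        + 136 * (2 * s + α + 2 * s * α) * (1 + 6 * s) * ((L : ℝ) ^ d * ddQ L (fun x μ => ‖A x μ‖) q κ)
      ≤ (1 + 6 * s) * avQ L (fun x μ => ‖A x μ‖) q κ + (140 * α + 280 * s) * ((L : ℝ) ^ d * ddQ L (fun x μ => ‖A x μ‖) q κ) :=
        add_le_add le_rfl (mul_le_mul_of_nonneg_right hcoef hdd0)
    _ = _ := by ring

end Complex

end Literature.MathematicalPhysics.QuantumFieldTheory.Balaban1983to89.B7Ineq139Cplx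

end
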